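/-
Copyright: cell `pub-ymgap` (HUMAN RULING D-0062), Track A of `YM-PLAN.md`, DAG node N20 (= NE7b); R134 acceleration seat
`pub-ymgap-dag-n20-c` (strategy s1, generation 8), module 43.  Released under the licence of the surrounding project.
-/
import Summits.QuantumFields.YangMills.Theorems.BalabanUVNodesN20LCSHullSeparation
import HarnessLib

/-!
# YM-DAG node N20 (= NE7b), row s1, module 43: THE REGIME OF THE GEOMETRIC SEPARATION — what module 42's nesting letter asks of `M`
# (`(r₂+1)·L·M₂ ≤ 4·M`, print's «M much larger than M₂»), a sufficient condition in print's letters, and the kernel certificate that the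
# record's displayed bookkeeping defaults `M = M₂ = 1` lie OUTSIDE it

Track A of `YM-PLAN.md` (cell `pub-ymgap`, HUMAN RULING D-0062), node **N20** = spine estimate NE7b (`T4WeightBudget.RelWeightBound`, NOT
PRINTED, NOT PROVED).  Seat `pub-ymgap-dag-n20-c` (R134, s1 «the first missing estimate»), generation 8, module 43 (imports module 42
`…N20LCSHullSeparation`).  Kernel theorems only: 0 `def`, 0 `sorry`, standard axioms; COUNT-NEUTRAL.  Elementary arithmetic over node00-def-T's ∕ def-R's
cube sides `sideχ j = L^{j+2}·M₂·R_{j+1}`, `sideD j = L^{j+1}·M·R_{j+1}` BY NAME; it asserts nothing of Bałaban's.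

WHY.  Module 42 proved that the box-hull of the next window's regularity regions misses the previous step's regularity regions — hence that the repaired
display of modules 39–41 is immune to module 38's forcing — under the NESTING LETTER
`(r₁+1)·sideχ k + L^{k+1}·ρ + (r₂+1)·sideχ (k+1) ≤ 4·sideD (k+1) + 2`.  THIS FILE says exactly which numerics that letter admits:
* §1 **NECESSITY**: the letter forces `(r₂ + 1)·L·M₂ ≤ 4·M` (`L_mul_M₂_le_of_nesting`) — print's regime *«M₁ < M₂ < M … M will be chosen much larger than
  M₂. The choice will be dictated by many conditions»* ([Balaban1988Convergent] p. 245), in which alone the four 𝐃_{k+2}-layers of the (3.2) window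
  (*«we surround … by four layers of the LMR_{k+1}-cubes»*, p. 264–265) are wider than a χ_{k+2}-cube collar; contrapositive `not_nesting_of_lt`; and
  ★ **`not_nesting_at_record_defaults`** — the record's displayed bookkeeping defaults `numerics7OfRecord₁₂` (`M₂ := 1`) with `towerNumericsOfRecord₁₂`
  (`M := 1`) (def-R's `Node00.Record12Numerics`: «displayed defaults, NOT print's undetermined constants») have `4·M = 4 < 12 ≤ (r₂+1)·L·M₂` (`L > 11`), so
  the letter holds there for NO `k, r₁, r₂, ρ`.  LOCATED (numerics, not a display defect): a record meant to carry the (3.2) window's separating role pins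
  `M ≥ ((r₁+1)·R_{k+1}∕R_{k+2} + (r₂+1)·L + 8)·M₂∕4`.
* §2 **SUFFICIENCY IN PRINT's LETTERS**: `display_radius_le` (`(d+3)L + 2 ≤ 8L` on the four-torus), ★ `nesting_of_M_large` — if `1 ≤ M₂`, the regularity
  scales grow by at most `B` per step (`R_{k+1} ≤ B·R_{k+2}`; along monotone couplings `B ∈ {1, L, …}`), `ρ ≤ 8L`, and **`((r₁+1)·B + (r₂+1)·L + 8)·M₂ ≤ 4·M`**,
  then the nesting letter holds at `k`.
* §3 ★★★ `disjoint_hull_labelAt_of_M_large`, `forced_plaquette_not_mem_hull_of_M_large` — module 42 §5 re-keyed to the print-letter regime of §2 at the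
  display's radius `ρ = (d+3)L + 2`: for `M` that large against `M₂`, EVERY admissible `X` of modules 40 ∕ 41 misses `R k c`, and module 38 §1's forced
  plaquette lies outside every such `X`.

HONEST FRAMING.  Arithmetic on the cube sides of record; the LOCALITY letter on `R`, the regularity letter `hreg`, «LCS-j on the hull of window-admissible
pins» ((A1c), THE wall), the reading and the 𝐑-step stay displayed as in modules 40 ∕ 41 ∕ 42.  NE7b NOT PRINTED ∕ NOT PROVED; (α)-instance 0∕1; N20 NOT
discharged; typed 28∕28, discharged count untouched; one finite four-torus at fixed `ε` — NOT ℝ⁴, NOT infinite volume, NOT OS, NOT a mass gap, NOT Clay.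

References (LOCATORS): T. Bałaban, CMP 119 (1988) 243–285 [Balaban1988Convergent] (p. 245 (`M₁ < M₂ < M`), (2.5) p. 255 (`R_j`), (2.17) p. 257,
(3.2)–(3.5) p. 264–265); CMP 109 (1987) 249–301 [Balaban1987RG1] ((0.1) p. 251, p. 257 (`M` ≫ the fixed scales)).
-/

set_option autoImplicit false

noncomputable section

namespace Summit.QuantumFields.YangMills.BalabanUVNodes.N20LCSHullSeparationRegime

open Literature.MathematicalPhysics.QuantumFieldTheory.Balaban1983to89
open Literature.MathematicalPhysics.QuantumFieldTheory.Balaban1983to89.T4Continuum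
open Literature.MathematicalPhysics.QuantumFieldTheory.Balaban1983to89.B14.Eq218Concrete
open Literature.MathematicalPhysics.QuantumFieldTheory.Balaban1983to89.Node00
open Literature.MathematicalPhysics.QuantumFieldTheory.Balaban1983to89.B15DeterminingSets (embIter)
open Literature.MathematicalPhysics.QuantumFieldTheory.Balaban1983to89.B14SeparationOfRecord (one_le_RkOfRecord)
open Summit.QuantumFields.YangMills.BalabanUVNodes.N20LCSAvgDominationRegion (boxRegion)
open Summit.QuantumFields.YangMills.BalabanUVNodes.N20LCSLabelTower
open Summit.QuantumFields.YangMills.BalabanUVNodes.N20LCSHullSeparation (disjoint_hull_labelAt forced_plaquette_not_mem_hull)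

/-! ## §1 Necessity: the nesting letter forces `(r₂+1)·L·M₂ ≤ 4·M`; the record's displayed defaults `M = M₂ = 1` are outside it -/

section Necessity

variable (F : T4Family) (ν : Stage7Numerics) (M : ℕ) (p : B12.RunParams) (g : ℕ → ℝ)

/-- **THE NESTING LETTER FORCES `M` LARGE AGAINST `L·M₂`**: if `(r₁+1)·sideχ k + L^{k+1}·ρ + (r₂+1)·sideχ (k+1) ≤ 4·sideD (k+1) + 2` then `(r₂ + 1)·L·M₂ ≤ 4·M` (its
third term alone reads `(r₂+1)·L·M₂·A ≤ 4·M·A + 2` with `A = L^{k+2}·R_{k+2} ≥ 3`).  Print's regime `M₁ < M₂ < M`, *«M will be chosen much larger than M₂»*.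
[cite: Balaban1988Convergent, p.245, p.264–265] -/
theorem L_mul_M₂_le_of_nesting {k r₁ r₂ ρ : ℕ}
    (hnum : (r₁ + 1) * sideχ F ν p g k + (F.P p.K).L ^ (k + 1) * ρ + (r₂ + 1) * sideχ F ν p g (k + 1) ≤ 4 * sideD F ν M p g (k + 1) + 2) :
    (r₂ + 1) * (F.P p.K).L * ν.M₂ ≤ 4 * M := by
  have hL : 2 ≤ (F.P p.K).L := (F.P p.K).hL.2
  have hR : 1 ≤ RkOfRecord (F.P p.K).L ν.r (g (k + 2)) := one_le_RkOfRecord (F.P p.K).L_pos _ _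
  have hA3 : 3 ≤ (F.P p.K).L ^ (k + 2) * RkOfRecord (F.P p.K).L ν.r (g (k + 2)) := by
    have h1 : (F.P p.K).L ^ 2 ≤ (F.P p.K).L ^ (k + 2) := Nat.pow_le_pow_right (F.P p.K).L_pos (by omega)
    have h4 : 4 ≤ (F.P p.K).L ^ 2 := by nlinarith
    calc 3 ≤ (F.P p.K).L ^ (k + 2) * 1 := by omega
      _ ≤ _ := Nat.mul_le_mul_left _ hR
  have h3 : (r₂ + 1) * sideχ F ν p g (k + 1) ≤ 4 * sideD F ν M p g (k + 1) + 2 := le_trans (Nat.le_add_left _ _) hnum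
  have e1 : sideχ F ν p g (k + 1) = (F.P p.K).L * ν.M₂ * ((F.P p.K).L ^ (k + 2) * RkOfRecord (F.P p.K).L ν.r (g (k + 2))) := by
    simp only [sideχ, cubeSide, show k + 1 + 1 = k + 2 from rfl]; ring
  have e2 : sideD F ν M p g (k + 1) = M * ((F.P p.K).L ^ (k + 2) * RkOfRecord (F.P p.K).L ν.r (g (k + 2))) := by
    simp only [sideD, dCubeSide, show k + 1 + 1 = k + 2 from rfl]; ring
  rw [e1, e2] at h3
  generalize (F.P p.K).L ^ (k + 2) * RkOfRecord (F.P p.K).L ν.r (g (k + 2)) = A at hA3 h3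
  by_contra hlt
  push Not at hlt
  have h5 : (4 * M + 1) * A ≤ (r₂ + 1) * (F.P p.K).L * ν.M₂ * A := Nat.mul_le_mul_right _ hlt
  nlinarith

/-- **… so numerics with `4·M < (r₂+1)·L·M₂` are OUTSIDE the separation's regime** (contrapositive). [cite: Balaban1988Convergent, p.245] -/
theorem not_nesting_of_lt {k r₁ r₂ ρ : ℕ} (hlt : 4 * M < (r₂ + 1) * (F.P p.K).L * ν.M₂) :
    ¬ ((r₁ + 1) * sideχ F ν p g k + (F.P p.K).L ^ (k + 1) * ρ + (r₂ + 1) * sideχ F ν p g (k + 1) ≤ 4 * sideD F ν M p g (k + 1) + 2) :=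
  fun h => absurd (L_mul_M₂_le_of_nesting F ν M p g h) (not_le.2 hlt)

/-- ★ **AT THE RECORD'S DISPLAYED DEFAULTS THE NESTING LETTER FAILS** (kernel certificate of the located numerics point): def-R's ∕ def-T's bookkeeping numerics
of record `numerics7OfRecord₁₂` (`M₂ := 1`) with `towerNumericsOfRecord₁₂` (`M := 1`) — «displayed defaults, NOT print's undetermined constants» — have
`4·M = 4 < 12 ≤ (r₂+1)·L·M₂` (`L > 11`), so for NO `k, r₁, r₂, ρ` does module 42's separation letter hold there: those defaults violate print's `M₁ < M₂ < M`
and sit outside the regime in which the (3.2) window separates consecutive regularity regions.  A NUMERICS pin for a record meant to carry the window's role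
(`M ≥ ((r₁+1)·R_{k+1}∕R_{k+2} + (r₂+1)·L + 8)·M₂∕4`, §2), not a defect of any display. [cite: Balaban1988Convergent, p.245, p.264–265] -/
theorem not_nesting_at_record_defaults {k r₁ r₂ ρ : ℕ} :
    ¬ ((r₁ + 1) * sideχ F numerics7OfRecord₁₂ p g k + (F.P p.K).L ^ (k + 1) * ρ + (r₂ + 1) * sideχ F numerics7OfRecord₁₂ p g (k + 1) ≤
        4 * sideD F numerics7OfRecord₁₂ towerNumericsOfRecord₁₂.M p g (k + 1) + 2) := by
  refine not_nesting_of_lt F numerics7OfRecord₁₂ towerNumericsOfRecord₁₂.M p g ?_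
  have hL : 11 < (F.P p.K).L := by rw [T4Family.P_L]; exact F.hL11
  show 4 * 1 < (r₂ + 1) * (F.P p.K).L * 1
  nlinarith

end Necessity

/-! ## §2 Sufficiency in print's letters: `((r₁+1)·B + (r₂+1)·L + 8)·M₂ ≤ 4·M` with `R_{k+1} ≤ B·R_{k+2}` gives the nesting letter -/

section Sufficiency

variable (F : T4Family) (ν : Stage7Numerics) (M : ℕ) (p : B12.RunParams) (g : ℕ → ℝ)

/-- On the four-torus of record the display's box radius `(d+3)·L + 2 = 7L + 2` is at most `8L` (`L ≥ 2`). [cite: Balaban1987RG1, (0.1) p.251 (bookkeeping)] -/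
theorem display_radius_le : ((F.P p.K).d + 3) * (F.P p.K).L + 2 ≤ 8 * (F.P p.K).L := by
  have hL : 2 ≤ (F.P p.K).L := (F.P p.K).hL.2
  rw [T4Family.P_d]
  omega

/-- ★ **THE NESTING LETTER FROM «M MUCH LARGER THAN M₂»**: if `1 ≤ M₂`, the regularity scale grows by at most the factor `B` from step `k+2` back to step `k+1`
(`R_{k+1} ≤ B·R_{k+2}`), the box radius is `ρ ≤ 8L`, and **`((r₁+1)·B + (r₂+1)·L + 8)·M₂ ≤ 4·M`**, then
`(r₁+1)·sideχ k + L^{k+1}·ρ + (r₂+1)·sideχ (k+1) ≤ 4·sideD (k+1) + 2`. [cite: Balaban1988Convergent, p.245 («M will be chosen much larger than M₂»), (2.5) p.255, (2.17) p.257, p.264] -/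
theorem nesting_of_M_large {k r₁ r₂ ρ B : ℕ} (hM₂ : 1 ≤ ν.M₂)
    (hB : RkOfRecord (F.P p.K).L ν.r (g (k + 1)) ≤ B * RkOfRecord (F.P p.K).L ν.r (g (k + 2))) (hρ : ρ ≤ 8 * (F.P p.K).L)
    (hM : ((r₁ + 1) * B + (r₂ + 1) * (F.P p.K).L + 8) * ν.M₂ ≤ 4 * M) :
    (r₁ + 1) * sideχ F ν p g k + (F.P p.K).L ^ (k + 1) * ρ + (r₂ + 1) * sideχ F ν p g (k + 1) ≤ 4 * sideD F ν M p g (k + 1) + 2 := by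
  have hR : 1 ≤ RkOfRecord (F.P p.K).L ν.r (g (k + 2)) := one_le_RkOfRecord (F.P p.K).L_pos _ _
  have e0 : sideχ F ν p g k = (F.P p.K).L ^ (k + 1) * ((F.P p.K).L * ν.M₂ * RkOfRecord (F.P p.K).L ν.r (g (k + 1))) := by
    simp only [sideχ, cubeSide]; ring
  have e1 : sideχ F ν p g (k + 1) =
      (F.P p.K).L ^ (k + 1) * ((F.P p.K).L * ((F.P p.K).L * ν.M₂ * RkOfRecord (F.P p.K).L ν.r (g (k + 2)))) := by
    simp only [sideχ, cubeSide, show k + 1 + 1 = k + 2 from rfl]; ring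
  have e2 : sideD F ν M p g (k + 1) = (F.P p.K).L ^ (k + 1) * ((F.P p.K).L * M * RkOfRecord (F.P p.K).L ν.r (g (k + 2))) := by
    simp only [sideD, dCubeSide, show k + 1 + 1 = k + 2 from rfl]; ring
  rw [e0, e1, e2]
  -- reduce to the bracket inequality, then multiply by `L^{k+1}`
  set R₁ := RkOfRecord (F.P p.K).L ν.r (g (k + 1)) with hR₁
  set R₂ := RkOfRecord (F.P p.K).L ν.r (g (k + 2)) with hR₂
  set L := (F.P p.K).L with hLdef
  have key : (r₁ + 1) * (L * ν.M₂ * R₁) + ρ + (r₂ + 1) * (L * (L * ν.M₂ * R₂)) ≤ 4 * (L * M * R₂) := by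
    have h1 : (r₁ + 1) * (L * ν.M₂ * R₁) ≤ (r₁ + 1) * (L * ν.M₂ * (B * R₂)) :=
      Nat.mul_le_mul_left _ (Nat.mul_le_mul_left _ hB)
    have h2 : ρ ≤ 8 * L * (ν.M₂ * R₂) := by
      calc ρ ≤ 8 * L := hρ
        _ = 8 * L * 1 := (Nat.mul_one _).symm
        _ ≤ 8 * L * (ν.M₂ * R₂) := Nat.mul_le_mul_left _ (by simpa using Nat.mul_le_mul hM₂ hR)
    have h3 : L * (((r₁ + 1) * B + (r₂ + 1) * L + 8) * ν.M₂) * R₂ ≤ L * (4 * M) * R₂ :=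
      Nat.mul_le_mul_right _ (Nat.mul_le_mul_left _ hM)
    calc (r₁ + 1) * (L * ν.M₂ * R₁) + ρ + (r₂ + 1) * (L * (L * ν.M₂ * R₂))
        ≤ (r₁ + 1) * (L * ν.M₂ * (B * R₂)) + 8 * L * (ν.M₂ * R₂) + (r₂ + 1) * (L * (L * ν.M₂ * R₂)) := by omega
      _ = L * (((r₁ + 1) * B + (r₂ + 1) * L + 8) * ν.M₂) * R₂ := by ring
      _ ≤ L * (4 * M) * R₂ := h3
      _ = 4 * (L * M * R₂) := by ring
  have key' := Nat.mul_le_mul_left (L ^ (k + 1)) key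
  calc (r₁ + 1) * (L ^ (k + 1) * (L * ν.M₂ * R₁)) + L ^ (k + 1) * ρ + (r₂ + 1) * (L ^ (k + 1) * (L * (L * ν.M₂ * R₂)))
        = L ^ (k + 1) * ((r₁ + 1) * (L * ν.M₂ * R₁) + ρ + (r₂ + 1) * (L * (L * ν.M₂ * R₂))) := by ring
    _ ≤ L ^ (k + 1) * (4 * (L * M * R₂)) := key'
    _ = 4 * (L ^ (k + 1) * (L * M * R₂)) := by ring
    _ ≤ 4 * (L ^ (k + 1) * (L * M * R₂)) + 2 := Nat.le_add_right _ _

/-- **… AT THE DISPLAY's RADIUS** `ρ = (d+3)·L + 2`: `1 ≤ M₂`, `R_{k+1} ≤ B·R_{k+2}` and `((r₁+1)·B + (r₂+1)·L + 8)·M₂ ≤ 4·M` give module 42's nesting letter with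
`ρ := (d+3)L + 2`. [cite: Balaban1988Convergent, p.245, p.264–265] -/
theorem nesting_display_of_M_large {k r₁ r₂ B : ℕ} (hM₂ : 1 ≤ ν.M₂)
    (hB : RkOfRecord (F.P p.K).L ν.r (g (k + 1)) ≤ B * RkOfRecord (F.P p.K).L ν.r (g (k + 2)))
    (hM : ((r₁ + 1) * B + (r₂ + 1) * (F.P p.K).L + 8) * ν.M₂ ≤ 4 * M) :
    (r₁ + 1) * sideχ F ν p g k + (F.P p.K).L ^ (k + 1) * (((F.P p.K).d + 3) * (F.P p.K).L + 2) + (r₂ + 1) * sideχ F ν p g (k + 1) ≤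
      4 * sideD F ν M p g (k + 1) + 2 :=
  nesting_of_M_large F ν M p g hM₂ hB (display_radius_le F p) hM

end Sufficiency

/-! ## §3 Module 42 §5 in the print-letter regime -/

section Display

variable (F : T4Family) (N : ℕ) [NeZero N] (ν : Stage7Numerics) (M : ℕ) (p : B12.RunParams) (g : ℕ → ℝ)

/-- ★★★ **THE HULL OF WINDOW-ADMISSIBLE PINS MISSES THE PREVIOUS REGULARITY REGIONS — FOR `M` LARGE AGAINST `M₂` IN PRINT's LETTERS.**  With the LOCALITY letter on the
regularity regions `R j c` (within `r j` χ_{j+1}-layers of `c`), `0 < M`, `1 ≤ M₂`, `k + 1 ≤ m + K`, `R_{k+1} ≤ B·R_{k+2}` and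
`((r k + 1)·B + (r (k+1) + 1)·L + 8)·M₂ ≤ 4·M`: for EVERY history `h : Fin (k+1) → LabelPat`, every `c` of its last label's large family, every
`D ⊆ cubes32 (k+1) (seqOfHist (k+1) h)` and every `X` with `∀ q ∈ X, ∃ c″ ∈ D, ∃ p′ ∈ R (k+1) c″, q ∈ boxRegion (emb p′.src) ((d+3)L+2)` (module 40 §3's admissibility):
`Disjoint X (R k c)`. [cite: Balaban1988Convergent, p.245, (3.2)–(3.5) p.264–265; Balaban1989LargeFieldI, (0.3)–(0.5) p.176–177] -/
theorem disjoint_hull_labelAt_of_M_large (hM : 0 < M) (hM₂ : 1 ≤ ν.M₂) {k : ℕ} (hk : k + 1 ≤ (F.P p.K).m + (F.P p.K).K)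
    (R : (j : ℕ) → Iχ F ν p g j → Finset (Plaq (F.P p.K) (j + 1))) (r : ℕ → ℕ)
    (hR : ∀ (j : ℕ) (c : Iχ F ν p g j), ∀ p' ∈ R j c, embIter (j + 1) p'.src ∈ cubeEnl (F.P p.K) (sideχ F ν p g j) c (r j))
    {B : ℕ} (hB : RkOfRecord (F.P p.K).L ν.r (g (k + 1)) ≤ B * RkOfRecord (F.P p.K).L ν.r (g (k + 2)))
    (hMM : ((r k + 1) * B + (r (k + 1) + 1) * (F.P p.K).L + 8) * ν.M₂ ≤ 4 * M)
    (h : Fin (k + 1) → LabelPat F ν p g) {c : Iχ F ν p g k} (hc : c ∈ (labelAt F ν p g k (h (Fin.last k))).1)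
    {D : Finset (Iχ F ν p g (k + 1))} (hD : D ⊆ cubes32 F ν M p g (k + 1) (seqOfHist F ν M p g (k + 1) h))
    {X : Finset (Plaq (F.P p.K) (k + 1))}
    (hX : ∀ q ∈ X, ∃ c'' ∈ D, ∃ p' ∈ R (k + 1) c'', q ∈ boxRegion (emb p'.src) (((F.P p.K).d + 3) * (F.P p.K).L + 2)) :
    Disjoint X (R k c) :=
  disjoint_hull_labelAt F ν M p g hM hk R r hR (nesting_display_of_M_large F ν M p g hM₂ hB hMM) h hc hD hX

/-- ★★★ **MODULE 38 §1's FORCED PLAQUETTE LIES OUTSIDE EVERY ADMISSIBLE `X` — FOR `M` LARGE AGAINST `M₂` IN PRINT's LETTERS** (module 42's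
`forced_plaquette_not_mem_hull` with the nesting letter supplied by §2). [cite: Balaban1988Convergent, p.245, (3.2)–(3.5) p.264–265; Balaban1985Variational, Thm 1 p.279 (the SHAPE of `hreg`)] -/
theorem forced_plaquette_not_mem_hull_of_M_large (hM : 0 < M) (hM₂ : 1 ≤ ν.M₂) (A₁ : ℝ) (ρ₀ : cfgOfRecord F N p.K 0 → ℝ) {k : ℕ}
    (hk : k + 1 ≤ (F.P p.K).m + (F.P p.K).K)
    (R : (j : ℕ) → Iχ F ν p g j → Finset (Plaq (F.P p.K) (j + 1))) (r : ℕ → ℕ)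
    (hR : ∀ (j : ℕ) (c : Iχ F ν p g j), ∀ p' ∈ R j c, embIter (j + 1) p'.src ∈ cubeEnl (F.P p.K) (sideχ F ν p g j) c (r j))
    {B : ℕ} (hB : RkOfRecord (F.P p.K).L ν.r (g (k + 1)) ≤ B * RkOfRecord (F.P p.K).L ν.r (g (k + 2)))
    (hMM : ((r k + 1) * B + (r (k + 1) + 1) * (F.P p.K).L + 8) * ν.M₂ ≤ 4 * M)
    (h : Fin (k + 1) → LabelPat F ν p g) {c : Iχ F ν p g k} (hc : c ∈ (labelAt F ν p g k (h (Fin.last k))).1) {ε'' : ℝ}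
    (hreg : ∀ V' : GaugeField (F.P p.K) (k + 1) (SU N),
      (∀ p' ∈ R k c, dist1 (GaugeField.plaqHol V' p') < ε'') → chiFactor F N ν p g k c V' = 1)
    (V' : cfgOfRecord F N p.K (k + 1))
    (hne : (labelTowerOfRecord F N ν M p g A₁ (zeta316OfRecord F N ν M A₁)).eterm ρ₀ (k + 1) h V' ≠ 0)
    {D : Finset (Iχ F ν p g (k + 1))} (hD : D ⊆ cubes32 F ν M p g (k + 1) (seqOfHist F ν M p g (k + 1) h))
    {X : Finset (Plaq (F.P p.K) (k + 1))}
    (hX : ∀ q ∈ X, ∃ c'' ∈ D, ∃ p' ∈ R (k + 1) c'', q ∈ boxRegion (emb p'.src) (((F.P p.K).d + 3) * (F.P p.K).L + 2)) :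
    ∃ p' ∈ R k c, ε'' ≤ dist1 (GaugeField.plaqHol V' p') ∧ p' ∉ X :=
  forced_plaquette_not_mem_hull F N ν M p g hM A₁ ρ₀ hk R r hR (nesting_display_of_M_large F ν M p g hM₂ hB hMM) h hc hreg V' hne hD hX

end Display

end Summit.QuantumFields.YangMills.BalabanUVNodes.N20LCSHullSeparationRegime

end
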